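import Mathlib
import HarnessLib
import Summits.CriticalPhenomena.PercolationContinuityZ3.Theorems.PercNearOneGluingNoHeavyLowerTailKnQuestion8AntitheticRoutingDefs

/-!
# `NoHeavyLowerTail` (crux stmt-CriticalPhenomena-4575), antithetic vdBHK programme: the NECK LEMMA and the BASE of the routing-lemma
# induction (PROOF-RL-g43 P4, P2), abstractly

Support file (seat `prim-ineq-gen-7` gen 43; `--supports stmt-CriticalPhenomena-4575`).  Nothing is asserted about the crux; no `sorry`, no definitions.
Uses `…AntitheticRoutingDefs` (`AntitheticLegStr`, `Natural`, `neck`, `leafStr`).  Memo: PROOF-RL-g43.md P2, P4.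
* `AntitheticLegStr.natural_neck` — NECK LEMMA (P4): under the axioms of PROOF-RL P1′ (reflexive orders, `sub ρ° ρ → blt ρ° ρ`, `blt ρ (Φ ρ)`),
  `Natural S₁ ∧ Natural S₂ ⟹ Natural (neck S₁ S₂)` — two fibrewise stages with the `F*`-fibres `⋂_{ρ₁°⊆ρ₁} F*⟨ρ₁°⟩` and `F*⟨·,ρ₂′⟩`;
* `AntitheticLegStr.natural_leaf` — BASE: the 2-chain is natural.
-/

namespace Summit.CriticalPhenomena.PercolationContinuityZ3.Theorems

namespace AntitheticLegStr

variable {Λ₁ Λ₂ : Type*}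

/-- **NECK LEMMA (PROOF-RL-g43 P4).**  For leg structures whose orders are reflexive and which satisfy `sub ρ° ρ → blt ρ° ρ` and `blt ρ (Φ ρ)`
(PROOF-RL P1′: a sub-colouring's bottom lies below the top of the colouring; `b < Φ(b)`), naturality is preserved by the layered product.
Stage 1 matches the second coordinate inside the fibre over `ρ₁` with `F*₂(ρ₁) = {ρ₂ : (ρ₁°,ρ₂) ∈ F* for all ρ₁° ⊆ ρ₁}`; stage 2 matches the first
coordinate inside the fibre over the stage-1 target `ρ₂′` (tops read at `Φ₂ ρ₂′`) with `F*₁(ρ₂′) = F*⟨·,ρ₂′⟩`. [this work] -/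
theorem natural_neck [Fintype Λ₁] [DecidableEq Λ₁] [Fintype Λ₂] [DecidableEq Λ₂]
    (S₁ : AntitheticLegStr Λ₁) (S₂ : AntitheticLegStr Λ₂)
    (hsub₁ : ∀ x, S₁.sub x x) (hble₁ : ∀ x, S₁.ble x x) (htle₁ : ∀ x, S₁.tle x x)
    (hble₂ : ∀ x, S₂.ble x x) (htle₂ : ∀ x, S₂.tle x x)
    (hA3₁ : ∀ x x', S₁.sub x' x → S₁.blt x' x) (hA2₂ : ∀ x, S₂.blt x (S₂.Φ x))
    (hN₁ : S₁.Natural) (hN₂ : S₂.Natural) : (neck S₁ S₂).Natural := by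
  classical
  intro Db Dt Fs hDb hDt hcross hFs hL hFsDb
  have hbrefl₁ : ∀ x, S₁.blt x x := fun x => hA3₁ x x (hsub₁ x)
  -- STAGE 1: fibres over ρ₁
  have key2 : ∀ ρ₁ : Λ₁, ∃ φ : Λ₂ → Λ₂,
      (∀ ρ₂, (ρ₁, ρ₂) ∈ Db → (ρ₁, ρ₂) ∉ Dt →
        ((ρ₁, φ ρ₂) ∈ Db ∧ (ρ₁, S₂.Φ (φ ρ₂)) ∉ Dt ∧ S₂.blt ρ₂ (S₂.Φ (φ ρ₂)))) ∧
      (∀ ρ₂ ρ₂', (ρ₁, ρ₂) ∈ Db → (ρ₁, ρ₂) ∉ Dt → (ρ₁, ρ₂') ∈ Db → (ρ₁, ρ₂') ∉ Dt → φ ρ₂ = φ ρ₂' → ρ₂ = ρ₂') ∧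
      (∀ s, (ρ₁, s) ∈ Db → (ρ₁, S₂.Φ s) ∉ Dt → ∃ ρ₂, (ρ₁, ρ₂) ∈ Db ∧ (ρ₁, ρ₂) ∉ Dt ∧ φ ρ₂ = s) ∧
      (∀ ρ₂, (ρ₁, ρ₂) ∈ Db → (ρ₁, ρ₂) ∉ Dt → (∀ ρ₂', S₂.sub ρ₂' ρ₂ → ∀ x, S₁.sub x ρ₁ → (x, ρ₂') ∈ Fs) →
        (S₂.sub ρ₂ (S₂.Φ (φ ρ₂)) ∧ ∀ x, S₁.sub x ρ₁ → (x, φ ρ₂) ∈ Fs)) := by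
    intro ρ₁
    set Db2 : Finset Λ₂ := Finset.univ.filter (fun ρ₂ => (ρ₁, ρ₂) ∈ Db) with hDb2
    set Dt2 : Finset Λ₂ := Finset.univ.filter (fun σ₂ => (ρ₁, σ₂) ∈ Dt) with hDt2
    set Fs2 : Finset Λ₂ := Finset.univ.filter (fun ρ₂ => ∀ x, S₁.sub x ρ₁ → (x, ρ₂) ∈ Fs) with hFs2
    have m1 : ∀ ρ₂, ρ₂ ∈ Db2 ↔ (ρ₁, ρ₂) ∈ Db := by intro ρ₂; simp [hDb2]
    have m2 : ∀ σ₂, σ₂ ∈ Dt2 ↔ (ρ₁, σ₂) ∈ Dt := by intro σ₂; simp [hDt2]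
    have m3 : ∀ ρ₂, ρ₂ ∈ Fs2 ↔ ∀ x, S₁.sub x ρ₁ → (x, ρ₂) ∈ Fs := by intro ρ₂; simp [hFs2]
    obtain ⟨φ, h1, h2, h3, h4⟩ := hN₂ Db2 Dt2 Fs2
      (by intro ρ ρ' h hρ; rw [m1] at hρ ⊢; exact hDb _ _ ⟨hble₁ ρ₁, h⟩ hρ)
      (by intro σ σ' h hσ; rw [m2] at hσ ⊢; exact hDt _ _ ⟨htle₁ ρ₁, h⟩ hσ)
      (by intro ρ σ h hσ; rw [m2] at hσ; rw [m1]; exact hcross (ρ₁, ρ) (ρ₁, σ) ⟨hbrefl₁ ρ₁, h⟩ hσ)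
      (by intro ρ ρ' h hρ; rw [m3] at hρ ⊢; intro x hx; exact hFs (x, ρ) (x, ρ') ⟨hble₁ x, h⟩ (hρ x hx))
      (by intro ρ σ hσ h; rw [m2] at hσ; rw [m3]; intro x hx; exact hL (x, ρ) (ρ₁, σ) hσ ⟨hA3₁ ρ₁ x hx, h⟩)
      (by intro ρ hρ; rw [m3] at hρ; rw [m1]; exact hFsDb (hρ ρ₁ (hsub₁ ρ₁)))
    refine ⟨φ, ?_, ?_, ?_, ?_⟩
    · intro ρ₂ ha hb
      obtain ⟨q1, q2, q3⟩ := h1 ρ₂ ((m1 _).mpr ha) (fun hh => hb ((m2 _).mp hh))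
      exact ⟨(m1 _).mp q1, fun hh => q2 ((m2 _).mpr hh), q3⟩
    · intro ρ₂ ρ₂' ha hb ha' hb' he
      exact h2 ρ₂ ρ₂' ((m1 _).mpr ha) (fun hh => hb ((m2 _).mp hh)) ((m1 _).mpr ha') (fun hh => hb' ((m2 _).mp hh)) he
    · intro s hs hs'
      obtain ⟨ρ₂, r1, r2, r3⟩ := h3 s ((m1 _).mpr hs) (fun hh => hs' ((m2 _).mp hh))
      exact ⟨ρ₂, (m1 _).mp r1, fun hh => r2 ((m2 _).mpr hh), r3⟩
    · intro ρ₂ ha hb hq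
      obtain ⟨q1, q2⟩ := h4 ρ₂ ((m1 _).mpr ha) (fun hh => hb ((m2 _).mp hh))
        (by intro ρ₂' hρ₂'; rw [m3]; intro x hx; exact hq ρ₂' hρ₂' x hx)
      exact ⟨q1, (m3 _).mp q2⟩
  choose φ hφ1 hφ2 hφ3 hφ4 using key2
  -- STAGE 2: fibres over ρ₂′ with tops read at Φ₂ ρ₂′
  have key1 : ∀ z : Λ₂, ∃ ψ : Λ₁ → Λ₁,
      (∀ x, (x, z) ∈ Db → (x, S₂.Φ z) ∉ Dt →
        ((ψ x, z) ∈ Db ∧ (S₁.Φ (ψ x), S₂.Φ z) ∉ Dt ∧ S₁.blt x (S₁.Φ (ψ x)))) ∧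
      (∀ x x', (x, z) ∈ Db → (x, S₂.Φ z) ∉ Dt → (x', z) ∈ Db → (x', S₂.Φ z) ∉ Dt → ψ x = ψ x' → x = x') ∧
      (∀ s, (s, z) ∈ Db → (S₁.Φ s, S₂.Φ z) ∉ Dt → ∃ x, (x, z) ∈ Db ∧ (x, S₂.Φ z) ∉ Dt ∧ ψ x = s) ∧
      (∀ x, (x, z) ∈ Db → (x, S₂.Φ z) ∉ Dt → (∀ x', S₁.sub x' x → (x', z) ∈ Fs) →
        (S₁.sub x (S₁.Φ (ψ x)) ∧ (ψ x, z) ∈ Fs)) := by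
    intro z
    set Db1 : Finset Λ₁ := Finset.univ.filter (fun x => (x, z) ∈ Db) with hDb1
    set Dt1 : Finset Λ₁ := Finset.univ.filter (fun σ₁ => (σ₁, S₂.Φ z) ∈ Dt) with hDt1
    set Fs1 : Finset Λ₁ := Finset.univ.filter (fun x => (x, z) ∈ Fs) with hFs1
    have m1 : ∀ x, x ∈ Db1 ↔ (x, z) ∈ Db := by intro x; simp [hDb1]
    have m2 : ∀ σ, σ ∈ Dt1 ↔ (σ, S₂.Φ z) ∈ Dt := by intro σ; simp [hDt1]
    have m3 : ∀ x, x ∈ Fs1 ↔ (x, z) ∈ Fs := by intro x; simp [hFs1]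
    obtain ⟨ψ, h1, h2, h3, h4⟩ := hN₁ Db1 Dt1 Fs1
      (by intro ρ ρ' h hρ; rw [m1] at hρ ⊢; exact hDb _ _ ⟨h, hble₂ z⟩ hρ)
      (by intro σ σ' h hσ; rw [m2] at hσ ⊢; exact hDt (σ, S₂.Φ z) (σ', S₂.Φ z) ⟨h, htle₂ _⟩ hσ)
      (by intro ρ σ h hσ; rw [m2] at hσ; rw [m1]; exact hcross (ρ, z) (σ, S₂.Φ z) ⟨h, hA2₂ z⟩ hσ)
      (by intro ρ ρ' h hρ; rw [m3] at hρ ⊢; exact hFs (ρ, z) (ρ', z) ⟨h, hble₂ z⟩ hρ)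
      (by intro ρ σ hσ h; rw [m2] at hσ; rw [m3]; exact hL (ρ, z) (σ, S₂.Φ z) hσ ⟨h, hA2₂ z⟩)
      (by intro x hx; rw [m3] at hx; rw [m1]; exact hFsDb hx)
    refine ⟨ψ, ?_, ?_, ?_, ?_⟩
    · intro x ha hb
      obtain ⟨q1, q2, q3⟩ := h1 x ((m1 _).mpr ha) (fun hh => hb ((m2 _).mp hh))
      exact ⟨(m1 _).mp q1, fun hh => q2 ((m2 _).mpr hh), q3⟩
    · intro x x' ha hb ha' hb' he
      exact h2 x x' ((m1 _).mpr ha) (fun hh => hb ((m2 _).mp hh)) ((m1 _).mpr ha') (fun hh => hb' ((m2 _).mp hh)) he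
    · intro s hs hs'
      obtain ⟨x, r1, r2, r3⟩ := h3 s ((m1 _).mpr hs) (fun hh => hs' ((m2 _).mp hh))
      exact ⟨x, (m1 _).mp r1, fun hh => r2 ((m2 _).mpr hh), r3⟩
    · intro x ha hb hq
      obtain ⟨q1, q2⟩ := h4 x ((m1 _).mpr ha) (fun hh => hb ((m2 _).mp hh))
        (by intro x' hx'; rw [m3]; exact hq x' hx')
      exact ⟨q1, (m3 _).mp q2⟩
  choose ψ hψ1 hψ2 hψ3 hψ4 using key1
  -- the matching
  refine ⟨fun ρ => (ψ (φ ρ.1 ρ.2) ρ.1, φ ρ.1 ρ.2), ?_, ?_, ?_, ?_⟩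
  · rintro ⟨ρ₁, ρ₂⟩ ha hb
    obtain ⟨a1, a2, a3⟩ := hφ1 ρ₁ ρ₂ ha hb
    obtain ⟨b1, b2, b3⟩ := hψ1 (φ ρ₁ ρ₂) ρ₁ a1 a2
    refine ⟨b1, ?_, ?_⟩
    · simpa [neck] using b2
    · simpa [neck] using And.intro b3 a3
  · rintro ⟨ρ₁, ρ₂⟩ ⟨ρ₁', ρ₂'⟩ ha hb ha' hb' he
    simp only [Prod.mk.injEq] at he
    obtain ⟨he1, he2⟩ := he
    obtain ⟨a1, a2, -⟩ := hφ1 ρ₁ ρ₂ ha hb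
    obtain ⟨a1', a2', -⟩ := hφ1 ρ₁' ρ₂' ha' hb'
    rw [he2] at he1 a1 a2
    have e1 : ρ₁ = ρ₁' := hψ2 (φ ρ₁' ρ₂') ρ₁ ρ₁' a1 a2 a1' a2' he1
    subst e1
    have e2 : ρ₂ = ρ₂' := hφ2 ρ₁ ρ₂ ρ₂' ha hb ha' hb' he2
    subst e2
    rfl
  · rintro ⟨s₁, s₂⟩ hs hs'
    have hs'' : (S₁.Φ s₁, S₂.Φ s₂) ∉ Dt := by simpa [neck] using hs'
    obtain ⟨x, x1, x2, x3⟩ := hψ3 s₂ s₁ hs hs''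
    obtain ⟨ρ₂, r1, r2, r3⟩ := hφ3 x s₂ x1 x2
    refine ⟨(x, ρ₂), r1, r2, ?_⟩
    simp only [r3, x3]
  · rintro ⟨ρ₁, ρ₂⟩ ha hb hq
    have hq' : ∀ x, S₁.sub x ρ₁ → ∀ y, S₂.sub y ρ₂ → (x, y) ∈ Fs := by
      intro x hx y hy; exact hq (x, y) (by simpa [neck] using And.intro hx hy)
    obtain ⟨c2, f2⟩ := hφ4 ρ₁ ρ₂ ha hb (fun y hy x hx => hq' x hx y hy)
    obtain ⟨a1, a2, -⟩ := hφ1 ρ₁ ρ₂ ha hb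
    obtain ⟨c1, f1⟩ := hψ4 (φ ρ₁ ρ₂) ρ₁ a1 a2 (fun x' hx' => f2 x' hx')
    refine ⟨?_, f1⟩
    simpa [neck] using And.intro c1 c2

/-- **BASE (PROOF-RL-g43 P2).**  The 2-chain is natural. [this work] -/
theorem natural_leaf : leafStr.Natural := by
  classical
  intro Db Dt Fs _ _ _ _ _ hFsDb
  refine ⟨fun u => u, ?_, ?_, ?_, ?_⟩
  · intro ρ ha hb; exact ⟨ha, by simpa [leafStr] using hb, trivial⟩
  · intro ρ ρ' _ _ _ _ _; exact Subsingleton.elim _ _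
  · intro s hs hs'; exact ⟨s, hs, by simpa [leafStr] using hs', rfl⟩
  · intro ρ _ _ hq; exact ⟨trivial, hq ρ trivial⟩

end AntitheticLegStr

end Summit.CriticalPhenomena.PercolationContinuityZ3.Theorems
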